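import Summits.RiemannHypothesis.RiemannHypothesis.Theorems.WeilFormatCCinfHankelRange
import HarnessLib

/-!
# Format C, design C∞ (E2c, data side): CLAIMED TAG TABLES for the Hankel range — one kernel pass over the records, then cheap ranges

Route context: Fourier–Galerkin / Schur-complement certificates of Weil positivity on a window ("format C", C∞ door
`weilPositivityOn_of_cinf_pipeline`; supporting stmt-RiemannHypothesis-0098; seat rh-explicit-weil-2; companion of
`WeilFormatCCinfHankelRange`).

`CinfHankelR.rangeBox` recomputes the four tag boxes of every mode (including an `MI.logNat`) each time an entry is evaluated; with
≈ 550 entries per sector that is ≈ 3·10⁵ logarithms.  The K-layout idiom avoids it: the emitter CLAIMS the tag table once (a literal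
`List (List MI)`, one row of four boxes per mode of the range), ONE banded kernel pass certifies it against the record-derived boxes
(`checkTags` ⊇ `CinfHankelR.tagBox`), and every range is then a sum of products of LITERAL boxes (`rangeBoxTab`):

* `CinfHankelR.TagsValid S a m₀ I tags` — the first `I` rows enclose the tags at the modes `m₀ … m₀+I−1`;
* `checkTags` / ★ `tagsValid_extend`, `tagsValid_zero` — banded kernel certification from `Encl.TabColValid` + the `log` guard;
* `rangeBoxTab` / ★ `mem_rangeBoxTab` — the exact range over the claimed table (feeds `CinfHankelR.mem_entry`).

Interval bookkeeping; standard axioms; no RH claim.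
-/

set_option autoImplicit false
-- `Summit.RiemannHypothesis.RiemannHypothesis.…` is the layout-mandated namespace (summit = problem name).
set_option linter.dupNamespace false

open Finset
open scoped Real

namespace Summit.RiemannHypothesis.RiemannHypothesis.Theorems.WeilFormatC

namespace CinfHankelR

open Literature.NumberTheory.LFunctions Literature.NumberTheory.LFunctions.Yoshida1992
open Literature.Analysis.ValidatedNumerics Literature.Analysis.ValidatedNumerics.NumericsMP
open Encl (Consts ConstsValid IdxRec TabColValid tget within mem_of_within)
open CinfCoeff (logTagsOK mem_logTag rangeEntryBox mem_rangeEntryBox)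

variable {S : ℕ} {a : ℝ} {ks : List PrimeLen} {C : Consts}

/-- **Validity of a claimed tag table**: its first `I` rows enclose the four tags at the modes `m₀, …, m₀+I−1`. -/
def TagsValid (S : ℕ) (a : ℝ) (m₀ I : ℕ) (tags : List (List MI)) : Prop :=
  ∀ i < I, ∀ t : Fin 4, MI.mem S (tagT a t (m₀ + i)) ((tags.getD i []).getD t default)

/-- The empty prefix. -/
theorem tagsValid_zero {m₀ : ℕ} {tags : List (List MI)} : TagsValid S a m₀ 0 tags := fun _ h ↦ absurd h (by omega)

/-- **Band checker**: for the modes `m₀+i0 … m₀+i0+n−1`, every claimed tag box contains the record-derived box. -/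
def checkTags (S K : ℕ) (C : Consts) (ctab : List IdxRec) (m₀ : ℕ) (tags : List (List MI)) (i0 n : ℕ) : Bool :=
  (List.range n).all fun d ↦ (List.range 4).all fun t ↦
    within (tagBox S K C (tget ctab (m₀ + (i0 + d))) (m₀ + (i0 + d)) t) ((tags.getD (i0 + d) []).getD t default)

/-- ★ **Band soundness**: a certified prefix of `i0` rows extends by a passing band of `n` rows (records valid on
`[lo, hi) ⊇ [m₀+i0, m₀+i0+n)`, `log` guard on the band). -/
theorem tagsValid_extend (hS : 0 < S) (hks : PrimeData a ks) (hC : ConstsValid S a ks C) {ctab : List IdxRec} {lo hi : ℕ}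
    (hCT : TabColValid S a ks lo hi ctab) {m₀ K i0 n : ℕ} (hlo : lo ≤ m₀ + i0) (hhi : m₀ + i0 + n ≤ hi)
    (hlog : logTagsOK S K (m₀ + i0) n = true) {tags : List (List MI)} (h1 : TagsValid S a m₀ i0 tags)
    (h : checkTags S K C ctab m₀ tags i0 n = true) : TagsValid S a m₀ (i0 + n) tags := by
  intro i hi t
  by_cases hlt : i < i0
  · exact h1 i hlt t
  · obtain ⟨d, rfl⟩ : ∃ d, i = i0 + d := ⟨i - i0, by omega⟩
    have hd : d < n := by omega
    unfold checkTags at h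
    rw [List.all_eq_true] at h
    have h2 := h d (List.mem_range.2 hd)
    rw [List.all_eq_true] at h2
    have h3 := h2 t (List.mem_range.2 t.isLt)
    have hrec := (hCT (m₀ + (i0 + d)) (by omega) (by omega)).1
    have hlg := mem_logTag hS hlog d hd
    rw [show m₀ + i0 + d = m₀ + (i0 + d) by omega] at hlg
    have hm := mem_tagBox hS hks hC (m := m₀ + (i0 + d)) (by exact_mod_cast hrec) hlg t
    exact mem_of_within h3 hm

/-- **Range box over a claimed tag table** (cheap: products of literal boxes). -/
def rangeBoxTab (S : ℕ) (tags : List (List MI)) (m₀ L t t' s : ℕ) : MI :=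
  rangeEntryBox S (fun i ↦ (tags.getD i []).getD t default) (fun i ↦ (tags.getD i []).getD t' default) m₀ L s

/-- ★ `rangeBoxTab ∋` the exact range `Σ_{m∈[m₀,m₀+L)} T_t T_t' (m₀/m)^s` for a valid tag table. -/
theorem mem_rangeBoxTab (hS : 0 < S) {m₀ L : ℕ} {tags : List (List MI)} (htags : TagsValid S a m₀ L tags)
    (t t' : Fin 4) (s : ℕ) :
    MI.mem S (∑ m ∈ Finset.Ico m₀ (m₀ + L), tagT a t m * tagT a t' m * ((m₀ : ℝ) / (m : ℝ)) ^ s)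
      (rangeBoxTab S tags m₀ L t t' s) :=
  mem_rangeEntryBox hS (T := tagT a t) (T' := tagT a t') (fun i hi ↦ htags i hi t) (fun i hi ↦ htags i hi t') s

end CinfHankelR

end Summit.RiemannHypothesis.RiemannHypothesis.Theorems.WeilFormatC
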